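import Literature.NumberTheory.Automorphic.TateLocalZetaShells
import Literature.NumberTheory.Automorphic.LocalPiSchwartzBruhatFourier
import Literature.NumberTheory.Automorphic.LocalFieldHaarBalls
import HarnessLib

/-!
# Homotheties on `𝒮(Fⁿ)`: unit-group invariance, shells, and Haar integrals over `Fˣ` as finite coset sums

Topic `NumberTheory/Automorphic`; namespace `Literature.NumberTheory.Automorphic`.  KERNEL ONLY: theorems; no
definition, no named fact, no `sorry`.  Groundwork for the type II computation of [MoeglinVignerasWaldspurger1987,
Chap. 3 §III.2–III.3, III.7] (the coinvariants of `𝒮(Fⁿ)` under the homotheties `Φ ↦ Φ(t ·)`, `t ∈ Fˣ`), over a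
non-archimedean local field `F` (`|·| = normAbs`, `𝔭^m = primePowBall F m`, boxes `(𝔭^m)^ι = piPrimePowBall F ι m`,
unit filtration `U^n = unitFiltration F n`):

* §1 `U^n` is an open subgroup of `Fˣ` inside the unit group `{|t| = 1}` (`exists_subgroup_coe_eq_unitFiltration`);
* §2 **every `Φ ∈ 𝒮(F^ι)` is invariant under the homotheties of some `U^n`**: `Φ(u • x) = Φ(x)`
  (`exists_forall_unitFiltration_smul_eq`) — support in a box `(𝔭^M)^ι` and `(𝔭^N)^ι`-periodicity;
* §3 homotheties and boxes ∕ shells: `t • x ∈ (𝔭^m)^ι ↔ x ∈ (𝔭^{m-k})^ι` for `|t| = q^{-k}`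
  (`smul_mem_piPrimePowBall_iff`), the restriction of `Φ ∈ 𝒮(F^ι)` to a shell `(𝔭^k)^ι ∖ (𝔭^{k+1})^ι` is again in
  `𝒮(F^ι)` (`indicator_sdiff_piPrimePowBall_mem_schwartzBruhat`);
* §4 **a Haar integral over `Fˣ` of a `U`-invariant function supported on finitely many cosets is a finite sum**
  (`integral_eq_sum_mul_of_forall_mul_mem`), and the unit group is a finite disjoint union of `U`-cosets
  (`exists_finset_cosets_cover_units`) — [Tate1950, §2.5]: «`𝔲 = ⋃ (1 + 𝔭^ν) ε`, a finite disjoint union».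

## References
* [MoeglinVignerasWaldspurger1987] C. Mœglin, M.-F. Vignéras, J.-L. Waldspurger, LNM 1291 (1987), Chap. 3 §III.2–III.3.
* [Tate1950] J. Tate, *Fourier analysis in number fields and Hecke's zeta-functions*, §2.2–2.5.
* [WeilBNT1967] A. Weil, *Basic Number Theory* (1967), Ch. II §2.
* [BushnellHenniart2006] C. J. Bushnell, G. Henniart, *The local Langlands conjecture for GL(2)*, §1.1, §23.1.
-/

set_option autoImplicit false

noncomputable section

open scoped NNReal ENNReal Topology Pointwise
open MeasureTheory ValuativeRel Filter Set Function
  Literature.NumberTheory.GaloisRepresentations.IsNonarchimedeanLocalField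

namespace Literature.NumberTheory.Automorphic

variable {F : Type*} [Field F] [ValuativeRel F] [TopologicalSpace F] [IsNonarchimedeanLocalField F]

/-! ## §1 The unit filtration as open subgroups of `Fˣ` -/

/-- **`U^n` is a subgroup of `Fˣ`** (ultrametric: `xy - 1 = (x-1)y + (y-1)`,
`x⁻¹ - 1 = -x⁻¹(x-1)`, `|x| = |y| = 1`), open (`unitFiltration_mem_nhds_one`) and contained in the unit group.
[cite: BushnellHenniart2006, §1.1] -/
theorem exists_subgroup_coe_eq_unitFiltration (n : ℕ) :
    ∃ U : Subgroup Fˣ, (U : Set Fˣ) = unitFiltration F n ∧ IsOpen (U : Set Fˣ) := by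
  have hmul : ∀ {x y : Fˣ}, x ∈ unitFiltration F n → y ∈ unitFiltration F n → x * y ∈ unitFiltration F n := by
    intro x y hx hy
    refine ⟨by rw [Units.val_mul, map_mul, hx.1, hy.1, mul_one], ?_⟩
    have h : ((x * y : Fˣ) : F) - 1 = ((x : F) - 1) * y + ((y : F) - 1) := by rw [Units.val_mul]; ring
    rw [h]
    refine (normAbs_add_le_max _ _).trans (max_le ?_ hy.2)
    rw [map_mul, hy.1, mul_one]; exact hx.2
  have hinv : ∀ {x : Fˣ}, x ∈ unitFiltration F n → x⁻¹ ∈ unitFiltration F n := by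
    intro x hx
    have hx1 : normAbs F ((x⁻¹ : Fˣ) : F) = 1 := by
      have := congrArg (normAbs F) (x.inv_mul : ((x⁻¹ : Fˣ) : F) * x = 1)
      rw [map_mul, hx.1, mul_one, map_one] at this
      exact this
    refine ⟨hx1, ?_⟩
    have h : ((x⁻¹ : Fˣ) : F) - 1 = -(((x⁻¹ : Fˣ) : F) * ((x : F) - 1)) := by
      rw [mul_sub, mul_one, ← Units.val_mul, inv_mul_cancel, Units.val_one]; ring
    rw [h, normAbs_neg, map_mul, hx1, one_mul]; exact hx.2
  let U : Subgroup Fˣ :=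
    { carrier := unitFiltration F n
      mul_mem' := fun hx hy => hmul hx hy
      one_mem' := ⟨by rw [Units.val_one, map_one], by rw [Units.val_one, sub_self, map_zero]; exact bot_le⟩
      inv_mem' := fun hx => hinv hx }
  refine ⟨U, rfl, ?_⟩
  change IsOpen (unitFiltration F n)
  rw [isOpen_iff_mem_nhds]
  intro x hx
  have h1 := unitFiltration_mem_nhds_one (F := F) n
  have hc : Continuous fun y : Fˣ => x⁻¹ * y := continuous_const.mul continuous_id
  have h2 : (fun y => x⁻¹ * y) ⁻¹' unitFiltration F n ∈ 𝓝 x := by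
    refine hc.continuousAt.preimage_mem_nhds ?_
    have : x⁻¹ * x = 1 := inv_mul_cancel x
    rw [this]
    exact h1
  refine Filter.mem_of_superset h2 fun y hy => ?_
  have : y = x * (x⁻¹ * y) := by rw [mul_inv_cancel_left]
  rw [this]; exact hmul hx hy

/-! ## §2 Schwartz–Bruhat functions on `F^ι` are invariant under small homotheties -/

section Pi

variable {ι : Type*} [Fintype ι]

omit [Fintype ι] in
/-- `|t| = q^{-k}` ⇒ `t • x ∈ (𝔭^m)^ι ↔ x ∈ (𝔭^{m-k})^ι`. [cite: WeilBNT1967, Ch. II §2, Def. 2] -/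
theorem smul_mem_piPrimePowBall_iff {t : F} {k : ℤ} (ht : normAbs F t = (residueFieldCard F : ℝ≥0)⁻¹ ^ k) {m : ℤ}
    {x : ι → F} : t • x ∈ piPrimePowBall F ι m ↔ x ∈ piPrimePowBall F ι (m - k) := by
  rw [mem_piPrimePowBall_iff, mem_piPrimePowBall_iff]
  refine forall_congr' fun i => ?_
  rw [Pi.smul_apply, smul_eq_mul, mul_mem_primePowBall_iff ht]

omit [Fintype ι] in
/-- `|u| = 1` ⇒ `u • x ∈ (𝔭^m)^ι ↔ x ∈ (𝔭^m)^ι`. [cite: WeilBNT1967, Ch. II §2, Def. 2] -/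
theorem smul_mem_piPrimePowBall_iff_of_normAbs_eq_one {u : F} (hu : normAbs F u = 1) {m : ℤ} {x : ι → F} :
    u • x ∈ piPrimePowBall F ι m ↔ x ∈ piPrimePowBall F ι m := by
  rw [smul_mem_piPrimePowBall_iff (k := 0) (by rw [zpow_zero]; exact hu), sub_zero]

omit [Fintype ι] in
/-- `(u - 1) • x ∈ (𝔭^{n+M})^ι` for `u ∈ U^n`, `x ∈ (𝔭^M)^ι`. [cite: WeilBNT1967, Ch. II §2, Def. 2] -/
private theorem sub_one_smul_mem_piPrimePowBall {n : ℕ} {u : Fˣ} (hu : u ∈ unitFiltration F n) {M : ℤ} {x : ι → F}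
    (hx : x ∈ piPrimePowBall F ι M) : ((u : F) - 1) • x ∈ piPrimePowBall F ι (n + M) := by
  rw [mem_piPrimePowBall_iff] at hx ⊢
  intro i
  rw [Pi.smul_apply, smul_eq_mul, mem_primePowBall_iff, map_mul, zpow_add₀ inv_residueFieldCard_pos.ne',
    zpow_natCast]
  exact mul_le_mul' hu.2 (hx i)

/-- **Every `Φ ∈ 𝒮(F^ι)` is invariant under the homotheties `x ↦ u • x`, `u ∈ U^n`, for some `n ≥ 1`**: `Φ` is
supported in a box `(𝔭^M)^ι` and `(𝔭^N)^ι`-periodic, and `u • x - x = (u-1) • x ∈ (𝔭^{n+M})^ι ⊆ (𝔭^N)^ι` for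
`x` in the box, `n ≥ N - M`; off the box both sides vanish (`|u| = 1`). [cite: WeilBNT1967, Ch. VII §2, Def. 1] -/
theorem exists_forall_unitFiltration_smul_eq {Φ : (ι → F) → ℂ} (hΦ : Φ ∈ SchwartzBruhat (ι → F)) :
    ∃ n : ℕ, 1 ≤ n ∧ ∀ u ∈ unitFiltration F n, ∀ x, Φ ((u : F) • x) = Φ x := by
  obtain ⟨M, hM⟩ := exists_eq_zero_of_notMem_piPrimePowBall hΦ
  obtain ⟨N, hN⟩ := exists_forall_add_eq_of_mem_schwartzBruhat_pi hΦ
  refine ⟨(N - M).toNat + 1, by omega, fun u hu x => ?_⟩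
  by_cases hx : x ∈ piPrimePowBall F ι M
  · have hmem : ((u : F) - 1) • x ∈ piPrimePowBall F ι N :=
      piPrimePowBall_antitone (by push_cast; omega) (sub_one_smul_mem_piPrimePowBall hu hx)
    have := hN x _ hmem
    rwa [sub_smul, one_smul, add_sub_cancel] at this
  · rw [hM x hx, hM _ (mt (smul_mem_piPrimePowBall_iff_of_normAbs_eq_one hu.1).1 hx)]

/-! ## §3 Restriction to a shell -/

/-- **The restriction `1_S · Φ` of `Φ ∈ 𝒮(F^ι)` to a shell `S = (𝔭^k)^ι ∖ (𝔭^{k+1})^ι` lies in `𝒮(F^ι)`** (the shell is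
compact open). [cite: WeilBNT1967, Ch. VII §2, Def. 1] -/
theorem indicator_sdiff_piPrimePowBall_mem_schwartzBruhat {Φ : (ι → F) → ℂ} (hΦ : Φ ∈ SchwartzBruhat (ι → F)) (k : ℤ) :
    (piPrimePowBall F ι k \ piPrimePowBall F ι (k + 1)).indicator Φ ∈ SchwartzBruhat (ι → F) := by
  obtain ⟨hlc, hcs⟩ := (mem_schwartzBruhat_iff).1 hΦ
  have hSo : IsOpen (piPrimePowBall F ι k \ piPrimePowBall F ι (k + 1)) :=
    (isOpen_piPrimePowBall k).sdiff (isClosed_piPrimePowBall _)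
  have hSc : IsClosed (piPrimePowBall F ι k \ piPrimePowBall F ι (k + 1)) :=
    (isClosed_piPrimePowBall k).sdiff (isOpen_piPrimePowBall _)
  rw [mem_schwartzBruhat_iff]
  refine ⟨?_, hcs.mono fun x hx => ?_⟩
  · have hind : IsLocallyConstant ((piPrimePowBall F ι k \ piPrimePowBall F ι (k + 1)).indicator fun _ => (1 : ℂ)) := by
      rw [IsLocallyConstant.iff_exists_open]
      intro x
      by_cases hx : x ∈ piPrimePowBall F ι k \ piPrimePowBall F ι (k + 1)
      · exact ⟨_, hSo, hx, fun y hy => by rw [Set.indicator_of_mem hy, Set.indicator_of_mem hx]⟩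
      · exact ⟨_, hSc.isOpen_compl, hx, fun y hy => by rw [Set.indicator_of_notMem hy, Set.indicator_of_notMem hx]⟩
    have : (piPrimePowBall F ι k \ piPrimePowBall F ι (k + 1)).indicator Φ =
        fun x => (piPrimePowBall F ι k \ piPrimePowBall F ι (k + 1)).indicator (fun _ => (1 : ℂ)) x * Φ x := by
      funext x
      by_cases hx : x ∈ piPrimePowBall F ι k \ piPrimePowBall F ι (k + 1)
      · rw [Set.indicator_of_mem hx, Set.indicator_of_mem hx, one_mul]
      · rw [Set.indicator_of_notMem hx, Set.indicator_of_notMem hx, zero_mul]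
    rw [this]
    exact hind.mul hlc
  · exact Function.mem_support.2 fun h => Function.mem_support.1 hx (by rw [Set.indicator_apply_eq_zero]; exact fun _ => h)

end Pi

/-! ## §4 Haar integrals over `Fˣ` of `U`-invariant functions as finite coset sums -/

section Cosets

variable {G : Type*} [CommGroup G] [TopologicalSpace G] [IsTopologicalGroup G] [MeasurableSpace G] [BorelSpace G]

/-- **A Haar integral of a `U`-invariant function supported on finitely many `U`-cosets is a finite sum**:
for an open compact subgroup `U`, a finite set `s` of representatives of DISTINCT cosets, and `f` with `f(tu) = f(t)`
(`u ∈ U`) vanishing off `⋃_{g ∈ s} gU`, `∫ f dμ = Σ_{g ∈ s} μ(U) f(g)`. [cite: Tate1950, §2.5] -/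
theorem integral_eq_sum_mul_of_forall_mul_mem (μ : Measure G) [μ.IsMulLeftInvariant] [IsFiniteMeasureOnCompacts μ]
    (U : Subgroup G) (hUo : IsOpen (U : Set G)) (hUc : IsCompact (U : Set G)) (s : Finset G)
    (hs : (s : Set G).Pairwise fun a b => a⁻¹ * b ∉ U) (f : G → ℂ) (hf : ∀ t, ∀ u ∈ U, f (t * u) = f t)
    (hsupp : ∀ t, f t ≠ 0 → ∃ g ∈ s, g⁻¹ * t ∈ U) :
    ∫ t, f t ∂μ = ∑ g ∈ s, μ.real (U : Set G) * f g := by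
  classical
  -- the cosets
  set C : G → Set G := fun g => (fun t => g⁻¹ * t) ⁻¹' (U : Set G) with hC
  have hCm : ∀ g, MeasurableSet (C g) := fun g => (hUo.preimage (continuous_const.mul continuous_id)).measurableSet
  have hCμ : ∀ g, μ (C g) = μ U := fun g => measure_preimage_mul μ g⁻¹ _
  have hdisj : (s : Set G).Pairwise (Disjoint on C) := by
    intro a ha b hb hab
    rw [Function.onFun, Set.disjoint_left]
    intro t hta htb
    apply hs ha hb hab
    have : a⁻¹ * b = (a⁻¹ * t) * (b⁻¹ * t)⁻¹ := by group
    rw [this]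
    exact U.mul_mem hta (U.inv_mem htb)
  -- `f` is constant on each coset
  have hconst : ∀ g, ∀ t ∈ C g, f t = f g := by
    intro g t ht
    have : t = g * (g⁻¹ * t) := by rw [mul_inv_cancel_left]
    rw [this, hf g _ ht]
  -- support
  have hzero : ∀ t ∉ ⋃ g ∈ s, C g, f t = 0 := by
    intro t ht
    by_contra h
    obtain ⟨g, hg, hgt⟩ := hsupp t h
    exact ht (Set.mem_biUnion hg hgt)
  have hint : ∀ g ∈ s, IntegrableOn f (C g) μ := by
    intro g _
    have hfin : μ (C g) < ⊤ := by rw [hCμ]; exact hUc.measure_lt_top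
    refine (integrableOn_const (C := f g) hfin.ne).congr_fun (fun t ht => (hconst g t ht).symm) (hCm g)
  rw [← setIntegral_eq_integral_of_forall_compl_eq_zero (s := ⋃ g ∈ s, C g) (fun t ht => hzero t ht),
    integral_biUnion_finset s (fun g _ => hCm g) hdisj hint]
  refine Finset.sum_congr rfl fun g _ => ?_
  rw [setIntegral_congr_fun (hCm g) (fun t ht => hconst g t ht), setIntegral_const, Measure.real, hCμ,
    Complex.real_smul, ← Measure.real]

/-- **The unit group `{|t| = 1}` is a finite disjoint union of cosets of any open subgroup `U` contained in it**
(compactness of `𝒪ˣ`; cosets are open): there is a finite set `s ⊆ 𝒪ˣ` of representatives of distinct `U`-cosets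
covering `𝒪ˣ`. [cite: Tate1950, §2.5] -/
theorem exists_finset_cosets_cover_units (U : Subgroup Fˣ) (hUo : IsOpen (U : Set Fˣ))
    (hU1 : ∀ u ∈ U, normAbs F (u : F) = 1) :
    ∃ s : Finset Fˣ, (∀ g ∈ s, normAbs F (g : F) = 1) ∧ ((s : Set Fˣ).Pairwise fun a b => a⁻¹ * b ∉ U) ∧
      ∀ t : Fˣ, normAbs F (t : F) = 1 → ∃ g ∈ s, g⁻¹ * t ∈ U := by
  classical
  have hK : IsCompact {u : Fˣ | normAbs F (u : F) = 1} := by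
    have : {u : Fˣ | normAbs F (u : F) = 1} = {u : Fˣ | valuation F (u : F) = 1} := by
      ext u; exact normAbs_eq_one_iff_valuation_eq_one
    rw [this]; exact isCompact_units_valuation_eq_one
  -- cover by the open cosets `g • U`
  obtain ⟨t₀, ht₀, hcov⟩ := hK.elim_nhds_subcover (fun g => (fun t => g⁻¹ * t) ⁻¹' (U : Set Fˣ)) (fun g _ => by
    refine (hUo.preimage (continuous_const.mul continuous_id)).mem_nhds ?_
    change g⁻¹ * g ∈ U; rw [inv_mul_cancel]; exact U.one_mem)
  -- pick one representative per coset
  let q : Fˣ → Fˣ ⧸ U := QuotientGroup.mk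
  let s : Finset Fˣ := (t₀.image q).image Quotient.out
  have hrep : ∀ g ∈ s, ∃ g₀ ∈ t₀, g₀⁻¹ * g ∈ U := by
    intro g hg
    obtain ⟨c, hc, rfl⟩ := Finset.mem_image.1 hg
    obtain ⟨g₀, hg₀, rfl⟩ := Finset.mem_image.1 hc
    refine ⟨g₀, hg₀, ?_⟩
    rw [← QuotientGroup.eq]
    exact (Quotient.out_eq _).symm
  refine ⟨s, fun g hg => ?_, fun a ha b hb hab hmem => hab ?_, fun t ht => ?_⟩
  · obtain ⟨g₀, hg₀, hmem⟩ := hrep g hg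
    have : g = g₀ * (g₀⁻¹ * g) := by rw [mul_inv_cancel_left]
    rw [this, Units.val_mul, map_mul, ht₀ g₀ hg₀, hU1 _ hmem, mul_one]
  · obtain ⟨ca, hca, rfl⟩ := Finset.mem_image.1 ha
    obtain ⟨cb, hcb, rfl⟩ := Finset.mem_image.1 hb
    have h : q ca.out = q cb.out := QuotientGroup.eq.2 hmem
    have h' : ca = cb := by
      have e1 : q ca.out = ca := QuotientGroup.out_eq' ca
      have e2 : q cb.out = cb := QuotientGroup.out_eq' cb
      rw [← e1, ← e2, h]
    rw [h']
  · obtain ⟨g₀, hg₀, hmem⟩ := Set.mem_iUnion₂.1 (hcov ht)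
    refine ⟨(q g₀).out, Finset.mem_image.2 ⟨q g₀, Finset.mem_image.2 ⟨g₀, hg₀, rfl⟩, rfl⟩, ?_⟩
    have h1 : (q g₀).out⁻¹ * g₀ ∈ U := by rw [← QuotientGroup.eq, QuotientGroup.out_eq']
    have : (q g₀).out⁻¹ * t = ((q g₀).out⁻¹ * g₀) * (g₀⁻¹ * t) := by group
    rw [this]; exact U.mul_mem h1 hmem

end Cosets

end Literature.NumberTheory.Automorphic

end
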